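import Literature.MathematicalPhysics.QuantumFieldTheory.Balaban1983to89.B9CoReadingCoordsL2
import Literature.MathematicalPhysics.QuantumFieldTheory.Balaban1983to89.B9RWSums343Holder

/-!
# `Balaban1983to89.B9CoReadingCoordsHolder` — the HÖLDER PROBES of the κ-fold coordinate model: the (3.43) co-reading `H1ReadsNbr` of def-Y's
# reading `kernelFamilyB` HOLDS AT THE COORDINATE PINS, for every bond-sector letter and EVERY configuration `U`

T. Bałaban, *Propagators for lattice gauge theories in a background field*, Commun. Math. Phys. **99** (1985) 389–434
[`Balaban1985BackgroundPropagators`, "B9"]; [4] = T. Bałaban, *Propagators and renormalization transformations for lattice gauge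
theories. II*, Commun. Math. Phys. **96** (1984) 223–250 [`Balaban1984PropagatorsII`].

statement-level skeleton of published theorems with citation tags; proofs where landed; nothing here is a claim about the
Yang–Mills mass gap

THE PRINTED LOCI.  [B9] (3.40) p. 397: the covariant Hölder quotient *"|U(Γ_{x,x′})A(x′) − A(x)| ∕ |x − x′|^α"* over pairs in Δ̃(y), scale ξ = L^{−j};
(3.43) p. 398: *"‖ζ∇_U G(U)λ‖_α, ‖ζG(U)∇\*_Uλ‖_α ≦ B₀(α)(Lʲη)^{1−α}(‖ζ‖^ξ_α + |ζ|)e^{−δ₀d(y,y′)}|λ|, ζ ∈ C₀^∞(Δ̃(y))"*; (3.39) p. 397 (*"|A| = max_μ sup_x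
|A_μ(x)|"*); [4] (2.51)–(2.52) p. 232 (block majorants), (2.137) p. 247 (the pair parameter t = |x − x′|∕L^{j}).

WHY THIS FILE (seat n06-d g6; the last displayed CO-READING binders of the N06 certificate).  After `B9CoReadingCoords` (sup entries (3.42)),
`B9CoReadingCoordsGlob` ((3.47)), n06-k's `B9CoReadingCoordsL2 ∕ L2Pair ∕ L2S` ((3.46)) and `B9CoReadingCoordsH` ((3.133)), the certificate of record
(`…N06AtOpsYNuOfRecordV6EPairMT`, p531969) still DISPLAYS the Hölder co-readings `hH1 hH1A hH1N : H1ReadsNbr …` (and the input ∕ H-Hölder ones) over a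
FREE probe family `𝔭A : HolderProbes …`: n06-k's schema `B9RWSumsReadsNbr.H1ReadsNbr K U 𝔭 Rel r blk blkY ev evY T_L T_R` says that the (3.43)
quantity `K.h1 U λ β ζ` is `≤ c·(‖ζ‖^ξ_β + |ζ|)` whenever every probe `Φ^Y_β(U)` ∕ `Φ^X_β(U)` anchored within distance `r` of `y` is `≤ c` on `T_L(ev λ)` ∕
`T_R(evY λ)` (`ζ ∈ C₀^∞(Δ̃(y))`).  THIS FILE constructs the probes ON THE COORDINATE CARRIER and proves the schema for def-Y's `kernelFamilyB` — for
every letter `O`, EVERY configuration (no unitarity of the transporters is used), every real basis `b`, every `r ≥ 2`: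
* §1 (generic finite set `S`, slots `D`): the probe index `PK S D κ` = PAIR probes `((x, x′), ν, c, c′)` ⊕ TRANSPORTED POINT probes `((x, x′), ν, c, c′)`
  ⊕ POINT probes `(x, ν, c, c′)`, anchors `blkPK`; ★ the ℝ-linear probe map `probeK b g w w₀` (coordinate `c` of `Ψ(x) − R(g(x,x′))Ψ(x′)` weighted by
  `w(x, x′)`, of `R(g(x,x′))Ψ(x′)` weighted by `w₀(x′)`, of `Ψ(x)` weighted by `w₀(x)`, `Ψ` the re-assembled `(ν, ·, c′)`-slice); the operators `shiftR`,
  `transR`; ★ `wnorm_le_of_coords` (weighted domination of `‖(T(J ⊗ E))(x)‖`, `‖E‖ ≤ 1`, by the scaled coordinates — `norm_apply_liftY_le`).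
* §2 (index `i`, bond sector): the weights `wK α x x′ = (|x − x′|η)^{−α}` (the weight INSIDE def-Y's `holderQB`) and `w₀K α x = (L^{j(x)}η)^{−α}`, ★ the
  identity `wK_eq_tpar_mul : wK = t^{−α}·w₀K` (t = print's pair parameter of the cut-off class `‖ζ‖^ξ_α`, `B6KLevelCensusIndexV1.tpar`); ★ the probe
  letters `holderProbesK i b B cfg par bI : HolderProbes (geo9K i) B (XBK κ i) (XBK κ i) PK PK`; ★★ `holderQB_le_of_probes` — THE PRODUCT RULE: for
  `ζ` supported within block distance 1 of `β y` and `bI` 1-faithful, if all three probe families of the scaled coordinate model of `T` at `evDiagK J`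
  anchored within `r` of `y` are `≤ c`, then `holderQB (U(Γ)) α ζ (T ν (J ⊗ E)) ≤ c·(|ζ| + ‖ζ‖^ξ_α)` (`(kGeo i).cutH`), per admissible pair by
  `ζ(x)Ψ(x) − R(ζ(x′)Ψ(x′)) = ζ(x)(Ψ(x) − RΨ(x′)) + (ζ(x) − ζ(x′))RΨ(x′)` and the two degenerate cases.
* §3 ★★ `h1ReadsNbr_kernelFamilyB_coords` — `H1ReadsNbr (kernelFamilyB i B cfg O par) U₁ (holderProbesK …) (RelB i) r (blkBK bI) (blkBK bI) evBK evBK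
  (DcoK ∘ₗ GcoK) (GcoK ∘ₗ DscoK)`; §4 ★ `bond_h1ReadsNbr_of_pins` — the same under the certificate's pin equations (`blk = blkBK bI`, `G = GcoK …`,
  `D = DcoK …`, `Dstar = DscoK …`), radius 2: the binders `hH1N` (members G_D, G₁, 𝔊) and `hH1A` (member G) of the N06 certificate become `have`s once
  `𝔭A := holderProbesK …`.
HONEST SCOPE.  Finite-dimensional bookkeeping over def-Y's readings and the coordinate gadgets; the site-sector twin (`kernelFamilyS.h1`, binder `hH1`), the
input co-readings `InputReadsFam` (`hIR hIRA hIF`) and the H-kernel Hölder co-reading `CoReadsHHolderNbr` (`hHCN`) are NOT treated here (sequels); nothing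
of [B9] or [4] is asserted; COUNT-NEUTRAL; N06 NOT discharged; one finite 𝕋^{d+1} programme at fixed ε — nothing continuum, nothing about the mass gap.
Cell `pub-ymgap` (HUMAN RULING D-0062), Track A node N06 [B9], seat `pub-ymgap-dag-n06-d` (g6), 2026-08-27.
-/

noncomputable section

namespace Literature.MathematicalPhysics.QuantumFieldTheory.Balaban1983to89.B9CoReadingCoordsHolder

open LatticeFieldCalculus (supDist)
open B9Eq39Adjoint (R R_sub R_smul R_zero)
open B6GlobalChartV1 (PV domT blkV1)
open B6Geom246MultiLevelTorus (geomT triangle_refl_nonneg_T)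
open B6Ineq2142KLevelV1 (β lvl)
open B6KLevelCensusIndexV1 (KIdx Adm adm_symm tpar tpar_nonneg kGeo)
open B9GeoNormsKLevelV1 (geo9K geo9K_supNorm_nonneg geo9K_cutH_nonneg)
open B9GeoLemma21KLevelV1 (one_le_Mh one_le_P)
open B9Thm34Ext (toB6)
open B9CoRealizesRelAtLetters (RelB)
open B9RWSumsReadsNbr (nbr mem_nbr H1ReadsNbr)
open B9RWSums343Holder (HolderProbes)
open B9Thm39ReadingCoords (cR39 cR39_nonneg abs_repr_le)
open B9CoReadingCoords (assembleK assembleK_add assembleK_smul evDiagK assembleK_evDiagK coordOpK assembleK_coordOpK coordOpK_evDiagK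
  norm_apply_liftY_le cdBₗ cdsBₗ XBK evBK blkBK GcoK DcoK DscoK DcoK_comp_GcoK GcoK_comp_DscoK off_bound_evBK)
open Node00 (SiteY FBondY BlkY IBondY CfgY BallY liftY liftY_apply holderQB kernelFamilyB BondOpY BondParY cdB cdsB iSup_ball_le)

/-- **THE PROBE INDEX of the κ-fold coordinate carrier**: a PAIR probe `inl ((x, x′), ν, c, c′)` (coordinate `c` of the transported difference
`Ψ(x) − R(U(Γ_{x,x′}))Ψ(x′)` of the `(ν, ·, c′)`-slice, weighted), a TRANSPORTED POINT probe `inr (inl ((x, x′), ν, c, c′))` (coordinate `c` of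
`R(U(Γ_{x,x′}))Ψ(x′)`, weighted at `x′`) or a POINT probe `inr (inr (x, ν, c, c′))` (coordinate `c` of `Ψ(x)`, weighted).
[cite: Balaban1985BackgroundPropagators, (3.40) p.397 (the covariant Hölder quotient), dictionary] -/
abbrev PK (S D κ : Type) : Type := ((S × S) × D × κ × κ) ⊕ (((S × S) × D × κ × κ) ⊕ (S × D × κ × κ))

/-- the block (anchor) of a probe: the pair probe `((x, x′), …)` is anchored at `x`, the transported point probe `((x, x′), …)` at `x′` (the point whose
value it reads), the point probe `(x, …)` at `x`. [cite: Balaban1985BackgroundPropagators, (3.43) p.398 («ζ ∈ C₀^∞(Δ̃(y))»), dictionary] -/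
def blkPK {S D κ I : Type} (blk : S → I) : PK S D κ → I :=
  Sum.elim (fun p => blk p.1.1) (Sum.elim (fun p => blk p.1.2) (fun p => blk p.1))

variable {d ℓ : ℕ} {hd : 1 ≤ d + 1} {hL : Odd (ℓ + 1) ∧ 1 < ℓ + 1} {b₀ b₁ : ℝ}
variable {𝔸 : Type} [NormedRing 𝔸] [NormedAlgebra ℂ 𝔸]
variable {κ : Type} [Fintype κ] [DecidableEq κ]

/-! ## §1 Over a finite set: the probe map, the two transport operators, the weighted domination lemma -/

section Coords

variable {S D : Type} (b : Module.Basis κ ℝ 𝔸)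

/-- ★ **THE PROBE MAP**: on a coordinate vector `F`, the pair probe `((x, x′), ν, c, c′)` reads `w(x, x′) · repr_c (Ψ(x) − R(g(x, x′)) Ψ(x′))`, the
transported point probe `((x, x′), ν, c, c′)` reads `w₀(x′) · repr_c (R(g(x, x′)) Ψ(x′))` and the point probe `(x, ν, c, c′)` reads `w₀(x) · F(x, ν, c, c′)`,
where `Ψ := assembleK b ν c′ F` is the re-assembled `(ν, ·, c′)`-slice — ℝ-linear in `F`.  (The transported point probe is what makes the co-reading hold
for EVERY transporter, with no unitarity ∕ isometry hypothesis.) [cite: Balaban1985BackgroundPropagators, (3.40) p.397 + (3.43) p.398, dictionary] -/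
def probeK (g : S → S → 𝔸ˣ) (w : S → S → ℝ) (w₀ : S → ℝ) : (S × D × κ × κ → ℝ) →ₗ[ℝ] (PK S D κ → ℝ) where
  toFun F := Sum.elim
    (fun p => w p.1.1 p.1.2 * b.repr (assembleK b p.2.1 p.2.2.2 F p.1.1 - R (g p.1.1 p.1.2) (assembleK b p.2.1 p.2.2.2 F p.1.2)) p.2.2.1)
    (Sum.elim (fun p => w₀ p.1.2 * b.repr (R (g p.1.1 p.1.2) (assembleK b p.2.1 p.2.2.2 F p.1.2)) p.2.2.1)
      (fun p => w₀ p.1 * F p))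
  map_add' F G := by
    funext p
    rcases p with p | p | p
    · simp only [Sum.elim_inl, Pi.add_apply, assembleK_add, B9Eq39Adjoint.R_add, map_sub, map_add, Finsupp.sub_apply,
        Finsupp.add_apply]
      ring
    · simp only [Sum.elim_inr, Sum.elim_inl, Pi.add_apply, assembleK_add, B9Eq39Adjoint.R_add, map_add, Finsupp.add_apply]
      ring
    · simp only [Sum.elim_inr, Pi.add_apply, mul_add]
  map_smul' r F := by
    funext p
    rcases p with p | p | p
    · simp only [Sum.elim_inl, Pi.smul_apply, assembleK_smul, RingHom.id_apply, smul_eq_mul, R_smul, map_sub, map_smul,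
        Finsupp.sub_apply, Finsupp.smul_apply]
      ring
    · simp only [Sum.elim_inr, Sum.elim_inl, Pi.smul_apply, assembleK_smul, RingHom.id_apply, smul_eq_mul, R_smul, map_smul,
        Finsupp.smul_apply]
      ring
    · simp only [Sum.elim_inr, Pi.smul_apply, RingHom.id_apply, smul_eq_mul, mul_left_comm]

omit [DecidableEq κ] in
/-- the pair probe, evaluated. [cite: Balaban1985BackgroundPropagators, (3.40) p.397, dictionary] -/
theorem probeK_inl (g : S → S → 𝔸ˣ) (w : S → S → ℝ) (w₀ : S → ℝ) (F : S × D × κ × κ → ℝ) (p : (S × S) × D × κ × κ) :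
    probeK b g w w₀ F (Sum.inl p) =
      w p.1.1 p.1.2 * b.repr (assembleK b p.2.1 p.2.2.2 F p.1.1 - R (g p.1.1 p.1.2) (assembleK b p.2.1 p.2.2.2 F p.1.2)) p.2.2.1 := rfl

omit [DecidableEq κ] in
/-- the transported point probe, evaluated. [cite: Balaban1985BackgroundPropagators, (3.40) p.397, dictionary] -/
theorem probeK_inr_inl (g : S → S → 𝔸ˣ) (w : S → S → ℝ) (w₀ : S → ℝ) (F : S × D × κ × κ → ℝ) (p : (S × S) × D × κ × κ) :
    probeK b g w w₀ F (Sum.inr (Sum.inl p)) = w₀ p.1.2 * b.repr (R (g p.1.1 p.1.2) (assembleK b p.2.1 p.2.2.2 F p.1.2)) p.2.2.1 := rfl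

omit [DecidableEq κ] in
/-- the point probe, evaluated. [cite: Balaban1985BackgroundPropagators, (3.39) p.397, dictionary] -/
theorem probeK_inr_inr (g : S → S → 𝔸ˣ) (w : S → S → ℝ) (w₀ : S → ℝ) (F : S × D × κ × κ → ℝ) (p : S × D × κ × κ) :
    probeK b g w w₀ F (Sum.inr (Sum.inr p)) = w₀ p.1 * F p := rfl

/-- the transported difference against a fixed point as an ℝ-linear operator: `(shiftR g x′ f)(z) := f(z) − R(g) f(x′)`.
[cite: Balaban1985BackgroundPropagators, (3.40) p.397, dictionary] -/
def shiftR (g : 𝔸ˣ) (x' : S) : (S → 𝔸) →ₗ[ℝ] (S → 𝔸) where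
  toFun f := fun z => f z - R g (f x')
  map_add' f f' := by funext z; simp only [Pi.add_apply, B9Eq39Adjoint.R_add]; abel
  map_smul' r f := by funext z; simp only [Pi.smul_apply, RingHom.id_apply, R_smul, smul_sub]

/-- the transport of the value at a fixed point as an ℝ-linear operator: `(transR g x′ f)(z) := R(g) f(x′)`. [cite: Balaban1985BackgroundPropagators, (3.40) p.397, dictionary] -/
def transR (g : 𝔸ˣ) (x' : S) : (S → 𝔸) →ₗ[ℝ] (S → 𝔸) where
  toFun f := fun _ => R g (f x')
  map_add' f f' := by funext z; simp only [Pi.add_apply, B9Eq39Adjoint.R_add]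
  map_smul' r f := by funext z; simp only [Pi.smul_apply, RingHom.id_apply, R_smul]

omit [DecidableEq κ] in
/-- ★ **WEIGHTED DOMINATION BY THE COORDINATES**: for an ℝ-linear `T` on `S → 𝔸`, a weight `0 ≤ w`, `0 ≤ c` and `‖E‖ ≤ 1`: if
`|w · cR39 · repr_c ((T(J ⊗ b_{c′}))(x))| ≤ c` for all `c, c′` then `w · ‖(T(J ⊗ E))(x)‖ ≤ c`.
[cite: Balaban1985BackgroundPropagators, (3.39)–(3.40) p.397; Balaban1984PropagatorsII, (2.51) p.232] -/
theorem wnorm_le_of_coords [FiniteDimensional ℝ 𝔸] (T : (S → 𝔸) →ₗ[ℝ] (S → 𝔸)) (J : S → ℝ) (x : S) {w c : ℝ} (hw : 0 ≤ w) (hc : 0 ≤ c)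
    (h : ∀ cc cc' : κ, |w * (cR39 b * b.repr (T (liftY J (b cc')) x) cc)| ≤ c) {E : 𝔸} (hE : ‖E‖ ≤ 1) :
    w * ‖T (liftY J E) x‖ ≤ c := by
  rcases isEmpty_or_nonempty κ with hκ | hκ
  · have hA : ∀ v : 𝔸, v = 0 := fun v => by
      rw [← b.sum_repr v]; exact Finset.sum_eq_zero fun c _ => (hκ.false c).elim
    rw [hA (T (liftY J E) x), norm_zero, mul_zero]; exact hc
  · obtain ⟨q, -, hq⟩ := Finset.exists_max_image (Finset.univ : Finset (κ × κ)) (fun q => |b.repr (T (liftY J (b q.2)) x) q.1|)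
      Finset.univ_nonempty
    have hM : ∀ cc cc' : κ, |b.repr (T (liftY J (b cc')) x) cc| ≤ |b.repr (T (liftY J (b q.2)) x) q.1| :=
      fun cc cc' => hq (cc, cc') (Finset.mem_univ _)
    have h1 : ‖T (liftY J E) x‖ ≤ cR39 b * |b.repr (T (liftY J (b q.2)) x) q.1| := norm_apply_liftY_le b T J hE x hM
    have h2 : w * (cR39 b * |b.repr (T (liftY J (b q.2)) x) q.1|) ≤ c := by
      have := h q.1 q.2
      rwa [abs_mul, abs_mul, abs_of_nonneg hw, abs_of_nonneg (cR39_nonneg b)] at this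
    exact (mul_le_mul_of_nonneg_left h1 hw).trans h2

end Coords

/-! ## §2 At an index: the Hölder weights, the probe letters of the coordinate model, the core estimate of `obs` -/

section Index

variable [CompleteSpace 𝔸] (i : KIdx d ℓ hd hL b₀ b₁)

/-- the pair weight of (3.40) in print's units: `(|x − x′|·η)^{−α}` (`η = |c_f|⁻¹`) — the weight INSIDE def-Y's `holderQB`.
[cite: Balaban1985BackgroundPropagators, (3.40) p.397] -/
def wK (α : ℝ) (x x' : FBondY i) : ℝ := ((((supDist x.src x'.src : ℕ) : ℝ)) * |i.cf|⁻¹) ^ (-α)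

/-- the point weight `(L^{j(x)}η)^{−α}` (`j(x)` = the level of the block of `x`). [cite: Balaban1985BackgroundPropagators, (3.40)–(3.41) p.397, (3.43) p.398] -/
def w₀K (α : ℝ) (x : FBondY i) : ℝ := ((((ℓ + 1 : ℕ) : ℝ)) ^ (blkV1 i.hN i.D x).1.1 * |i.cf|⁻¹) ^ (-α)

omit [CompleteSpace 𝔸] in
/-- `0 ≤ wK`. [cite: Balaban1985BackgroundPropagators, (3.40) p.397, bookkeeping] -/
theorem wK_nonneg (α : ℝ) (x x' : FBondY i) : 0 ≤ wK i α x x' := Real.rpow_nonneg (by positivity) _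

omit [CompleteSpace 𝔸] in
/-- `0 ≤ w₀K`. [cite: Balaban1985BackgroundPropagators, (3.41) p.397, bookkeeping] -/
theorem w₀K_nonneg (α : ℝ) (x : FBondY i) : 0 ≤ w₀K i α x := Real.rpow_nonneg (by positivity) _

omit [CompleteSpace 𝔸] in
/-- the pair weight is symmetric. [cite: Balaban1985BackgroundPropagators, (3.40) p.397, bookkeeping] -/
theorem wK_comm (α : ℝ) (x x' : FBondY i) : wK i α x x' = wK i α x' x := by
  unfold wK; rw [B3TorusRadialSums.supDist_comm]

omit [CompleteSpace 𝔸] in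
/-- ★ the weight identity behind the product rule: `(|x − x′|η)^{−α} = t^{−α} · (L^{j(x)}η)^{−α}` with print's pair parameter `t = |x − x′|/L^{j(x)}`
(the weight of the cut-off class `‖ζ‖^ξ_α` times the point weight). [cite: Balaban1985BackgroundPropagators, (3.40)–(3.41) p.397; Balaban1984PropagatorsII, (2.137) p.247] -/
theorem wK_eq_tpar_mul (α : ℝ) (x x' : FBondY i) : wK i α x x' = tpar i x x' ^ (-α) * w₀K i α x := by
  unfold wK w₀K tpar
  have hL : (0 : ℝ) < (((ℓ + 1 : ℕ) : ℝ)) ^ (blkV1 i.hN i.D x).1.1 := by positivity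
  rw [← Real.mul_rpow (by positivity) (by positivity)]
  congr 1
  field_simp

variable (b : Module.Basis κ ℝ 𝔸) [FiniteDimensional ℝ 𝔸] (B : B9.Backgrounds) (cfg : B.Cfg → CfgY 𝔸 i) (par : BondParY 𝔸 i)

/-- ★ **THE HÖLDER PROBES OF THE COORDINATE MODEL** (`B9RWSums343Holder.HolderProbes` at the pins): probe lattices `PK` on both carriers, anchored
through the block map `bI` of the first point, probe maps `Φ^X_α(U) = Φ^Y_α(U) := probeK b (U(Γ_{·,·})) (wK α) (w₀K α)` — the weighted coordinates of the
transported differences and of the point values. [cite: Balaban1985BackgroundPropagators, (3.40) p.397 + (3.43) p.398; Balaban1984PropagatorsII, (2.51) p.232] -/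
def holderProbesK (bI : FBondY i → IBondY i) :
    HolderProbes (geo9K i) B (XBK κ i) (XBK κ i) (PK (FBondY i) (Fin (d + 1)) κ) (PK (FBondY i) (Fin (d + 1)) κ) where
  blkPX := blkPK bI
  blkPY := blkPK bI
  ΦX := fun U α => probeK b (fun x x' : FBondY i => par (cfg U) x.src x'.src) (wK i α) (w₀K i α)
  ΦY := fun U α => probeK b (fun x x' : FBondY i => par (cfg U) x.src x'.src) (wK i α) (w₀K i α)

variable {bI : FBondY i → IBondY i}

/-- ★★ **THE CORE OF `obs` — THE PRODUCT RULE FOR THE COVARIANT HÖLDER QUOTIENT, READ THROUGH THE PROBES.**  Let `bI` be 1-faithful and `2 ≤ r`; let the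
transporters `U(Γ)` be arbitrary units; let `ζ` be supported within block distance 1 of `β y` (`cutIn`).  If every pair
probe and every point probe of the scaled coordinate model of the family `T` at the diagonal evaluation of `J`, anchored within distance `r` of `y`, is `≤ c`
in absolute value, then for `‖E‖ ≤ 1` and every slot `ν`: `holderQB (ζ · T ν (J ⊗ E)) ≤ c · (|ζ| + ‖ζ‖^ξ_α)`.  Per admissible pair `(x, x′)`:
`ζ(x)Ψ(x) − R(ζ(x′)Ψ(x′)) = ζ(x)(Ψ(x) − RΨ(x′)) + (ζ(x) − ζ(x′))RΨ(x′)` when `ζ(x) ≠ 0 ≠ ζ(x′)` (pair probe at `x`, transported point probe at `x′`),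
one (transported) point probe when exactly one of `ζ(x), ζ(x′)` vanishes; the weight identity `wK_eq_tpar_mul` converts the pair weight into the cut-off's `t^{−α}` times the point weight.
[cite: Balaban1985BackgroundPropagators, (3.40) p.397 + (3.43) p.398; Balaban1984PropagatorsII, (2.51)–(2.52) p.232 + (2.54) p.233 + (2.137) p.247] -/
theorem holderQB_le_of_probes
    (hβ1 : ∀ x : FBondY i, (geomT i.D).dist (β i.hN i.D i.hk (bI x)) (blkV1 i.hN i.D x) ≤ 1) {r : ℝ} (hr : 2 ≤ r)
    (g : Site (PV d ℓ i.m i.K hd hL) 0 → Site (PV d ℓ i.m i.K hd hL) 0 → 𝔸ˣ)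
    (T : Fin (d + 1) → (FBondY i → 𝔸) →ₗ[ℝ] (FBondY i → 𝔸)) (J : FBondY i → ℝ) (α : ℝ) (z : FBondY i → ℝ) (y : IBondY i) {c : ℝ} (hc : 0 ≤ c)
    (hcut : ∀ f, z f ≠ 0 → (geomT i.D).dist (blkV1 i.hN i.D f) (β i.hN i.D i.hk y) ≤ 1)
    (hP : ∀ p : PK (FBondY i) (Fin (d + 1)) κ, (geomT i.D).dist (β i.hN i.D i.hk (blkPK bI p)) (β i.hN i.D i.hk y) ≤ r →
      |probeK b (fun x x' : FBondY i => g x.src x'.src) (wK i α) (w₀K i α) ((cR39 b • coordOpK b T) (evDiagK J)) p| ≤ c)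
    (E : BallY 𝔸) (ν : Fin (d + 1)) :
    holderQB i g α z (T ν (liftY J (E : 𝔸))) ≤ c * (kGeo i).cutH α z := by
  classical
  set F : XBK κ i → ℝ := (cR39 b • coordOpK b T) (evDiagK J) with hF
  set Ψ : FBondY i → 𝔸 := T ν (liftY J (E : 𝔸)) with hΨ
  have hE : ‖(E : 𝔸)‖ ≤ 1 := mem_closedBall_zero_iff.1 E.2
  -- the two sups of the cut-off class `|ζ| + ‖ζ‖^ξ_α`
  set S₀ : ℝ := ⨆ f, |z f| with hS₀
  set Hz : ℝ := ⨆ q : FBondY i × FBondY i, (if Adm i q.1 q.2 then tpar i q.1 q.2 ^ (-α) * |z q.1 - z q.2| else 0) with hHz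
  have hcutH : (kGeo i).cutH α z = S₀ + Hz := rfl
  have hS₀0 : 0 ≤ S₀ := Real.iSup_nonneg fun _ => abs_nonneg _
  have hzS : ∀ f, |z f| ≤ S₀ := fun f => le_ciSup (f := fun f => |z f|) (Finite.bddAbove_range _) f
  have hterm0 : ∀ q : FBondY i × FBondY i, 0 ≤ (if Adm i q.1 q.2 then tpar i q.1 q.2 ^ (-α) * |z q.1 - z q.2| else 0) := fun q => by
    split_ifs
    · exact mul_nonneg (Real.rpow_nonneg (tpar_nonneg i _ _) _) (abs_nonneg _)
    · exact le_rfl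
  have hHz0 : 0 ≤ Hz := Real.iSup_nonneg hterm0
  have hzH : ∀ x x' : FBondY i, Adm i x x' → tpar i x x' ^ (-α) * |z x - z x'| ≤ Hz := by
    intro x x' h
    have := le_ciSup (f := fun q : FBondY i × FBondY i => (if Adm i q.1 q.2 then tpar i q.1 q.2 ^ (-α) * |z q.1 - z q.2| else 0))
      (Finite.bddAbove_range _) (x, x')
    simpa only [if_pos h] using this
  have hcH0 : 0 ≤ c * (kGeo i).cutH α z := mul_nonneg hc (by rw [hcutH]; exact add_nonneg hS₀0 hHz0)
  -- anchors: a bond where `ζ ≠ 0` has its index bond within distance 2 ≤ r of y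
  have hnear : ∀ f, z f ≠ 0 → (geomT i.D).dist (β i.hN i.D i.hk (bI f)) (β i.hN i.D i.hk y) ≤ r := by
    intro f hf
    have htri := (triangle_refl_nonneg_T i.D (one_le_Mh i) (one_le_P i)).1 (β i.hN i.D i.hk (bI f)) (blkV1 i.hN i.D f) (β i.hN i.D i.hk y)
    linarith [hβ1 f, hcut f hf]
  -- the slices of the scaled coordinate vector
  have hFs : ∀ cc' : κ, assembleK b ν cc' F = cR39 b • T ν (liftY J (b cc')) := by
    intro cc'; rw [hF, LinearMap.smul_apply, assembleK_smul, assembleK_coordOpK, assembleK_evDiagK]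
  -- (a) the pair probe at an anchored `x`: the weighted transported difference of `Ψ` is `≤ c`
  have hpair : ∀ x x' : FBondY i, z x ≠ 0 → wK i α x x' * ‖Ψ x - R (g x.src x'.src) (Ψ x')‖ ≤ c := by
    intro x x' hx
    have h1 := fun cc cc' : κ => hP (Sum.inl ((x, x'), ν, cc, cc')) (hnear x hx)
    refine wnorm_le_of_coords b (shiftR (g x.src x'.src) x' ∘ₗ T ν) J x (wK_nonneg i α x x') hc (fun cc cc' => ?_) hE
    have h2 := h1 cc cc'
    rw [probeK_inl] at h2
    simp only [hFs cc', Pi.smul_apply, R_smul, ← smul_sub, map_smul, Finsupp.smul_apply, smul_eq_mul] at h2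
    exact h2
  -- (b) the point probe at an anchored `x`: the weighted point value of `Ψ` is `≤ c`
  have hpt : ∀ x : FBondY i, z x ≠ 0 → w₀K i α x * ‖Ψ x‖ ≤ c := by
    intro x hx
    have h1 := fun cc cc' : κ => hP (Sum.inr (Sum.inr (x, ν, cc, cc'))) (hnear x hx)
    refine wnorm_le_of_coords b (T ν) J x (w₀K_nonneg i α x) hc (fun cc cc' => ?_) hE
    have h2 := h1 cc cc'
    rw [probeK_inr_inr] at h2
    simp only [hF, LinearMap.smul_apply, Pi.smul_apply, coordOpK_evDiagK, smul_eq_mul] at h2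
    exact h2
  -- (c) the transported point probe of the pair `(x, x′)`, anchored at `x′`: the weighted transported value `R(U(Γ_{x,x′}))Ψ(x′)` is `≤ c`
  have hptR : ∀ x x' : FBondY i, z x' ≠ 0 → w₀K i α x' * ‖R (g x.src x'.src) (Ψ x')‖ ≤ c := by
    intro x x' hx'
    have h1 := fun cc cc' : κ => hP (Sum.inr (Sum.inl ((x, x'), ν, cc, cc'))) (hnear x' hx')
    have key := wnorm_le_of_coords b (transR (g x.src x'.src) x' ∘ₗ T ν) J x (w₀K_nonneg i α x') hc (fun cc cc' => ?_) hE
    · exact key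
    have h2 := h1 cc cc'
    rw [probeK_inr_inl] at h2
    simp only [hFs cc', Pi.smul_apply, R_smul, map_smul, Finsupp.smul_apply, smul_eq_mul] at h2
    exact h2
  -- scalar bookkeeping
  have hns : ∀ (r : ℝ) (X : 𝔸), ‖((r : ℝ) : ℂ) • X‖ = |r| * ‖X‖ := fun r X => by rw [norm_smul, Complex.norm_real, Real.norm_eq_abs]
  -- the sup over admissible pairs
  unfold holderQB
  refine Real.iSup_le (fun q => ?_) hcH0
  obtain ⟨x, x'⟩ := q
  split_ifs with hadm
  swap
  · exact hcH0
  show wK i α x x' * ‖((z x : ℝ) : ℂ) • Ψ x - R (g x.src x'.src) (((z x' : ℝ) : ℂ) • Ψ x')‖ ≤ c * (kGeo i).cutH α z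
  rw [hcutH, mul_add]
  by_cases hx : z x = 0 <;> by_cases hx' : z x' = 0
  · -- both vanish: the term is 0
    rw [hx, hx']; simp only [Complex.ofReal_zero, zero_smul, R_zero, sub_zero, norm_zero, mul_zero]
    exact add_nonneg (mul_nonneg hc hS₀0) (mul_nonneg hc hHz0)
  · -- ζ(x) = 0 ≠ ζ(x′): one point probe at x′, weight through t(x′, x)
    rw [hx]; simp only [Complex.ofReal_zero, zero_smul, zero_sub, norm_neg, R_smul, hns]
    have hw : wK i α x x' = tpar i x' x ^ (-α) * w₀K i α x' := by rw [wK_comm, wK_eq_tpar_mul]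
    calc wK i α x x' * (|z x'| * ‖R (g x.src x'.src) (Ψ x')‖)
        = (tpar i x' x ^ (-α) * |z x' - z x|) * (w₀K i α x' * ‖R (g x.src x'.src) (Ψ x')‖) := by rw [hw, hx, sub_zero]; ring
      _ ≤ Hz * c := mul_le_mul (hzH x' x (adm_symm i hadm)) (hptR x x' hx') (mul_nonneg (w₀K_nonneg i α x') (norm_nonneg _)) hHz0
      _ ≤ c * S₀ + c * Hz := by nlinarith [mul_nonneg hc hS₀0]
  · -- ζ(x) ≠ 0 = ζ(x′): one point probe at x, weight through t(x, x′)
    rw [hx']; simp only [Complex.ofReal_zero, zero_smul, R_zero, sub_zero, hns]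
    calc wK i α x x' * (|z x| * ‖Ψ x‖)
        = (tpar i x x' ^ (-α) * |z x - z x'|) * (w₀K i α x * ‖Ψ x‖) := by rw [wK_eq_tpar_mul, hx', sub_zero]; ring
      _ ≤ Hz * c := mul_le_mul (hzH x x' hadm) (hpt x hx) (mul_nonneg (w₀K_nonneg i α x) (norm_nonneg _)) hHz0
      _ ≤ c * S₀ + c * Hz := by nlinarith [mul_nonneg hc hS₀0]
  · -- both non-zero: the product rule
    have hsplit : ((z x : ℝ) : ℂ) • Ψ x - R (g x.src x'.src) (((z x' : ℝ) : ℂ) • Ψ x') =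
        ((z x : ℝ) : ℂ) • (Ψ x - R (g x.src x'.src) (Ψ x')) + (((z x - z x' : ℝ) : ℂ)) • R (g x.src x'.src) (Ψ x') := by
      rw [R_smul, smul_sub, Complex.ofReal_sub, sub_smul]; abel
    rw [hsplit]
    have hw : wK i α x x' = tpar i x' x ^ (-α) * w₀K i α x' := by rw [wK_comm, wK_eq_tpar_mul]
    calc wK i α x x' * ‖((z x : ℝ) : ℂ) • (Ψ x - R (g x.src x'.src) (Ψ x')) + ((z x - z x' : ℝ) : ℂ) • R (g x.src x'.src) (Ψ x')‖
        ≤ wK i α x x' * (|z x| * ‖Ψ x - R (g x.src x'.src) (Ψ x')‖ + |z x - z x'| * ‖R (g x.src x'.src) (Ψ x')‖) := by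
          refine mul_le_mul_of_nonneg_left ((norm_add_le _ _).trans ?_) (wK_nonneg i α x x')
          rw [hns, hns]
      _ = |z x| * (wK i α x x' * ‖Ψ x - R (g x.src x'.src) (Ψ x')‖) +
            (tpar i x' x ^ (-α) * |z x' - z x|) * (w₀K i α x' * ‖R (g x.src x'.src) (Ψ x')‖) := by
          rw [abs_sub_comm (z x) (z x'), hw]; ring
      _ ≤ S₀ * c + Hz * c := add_le_add (mul_le_mul (hzS x) (hpair x x' hx) (mul_nonneg (wK_nonneg i α x x') (norm_nonneg _)) hS₀0)
          (mul_le_mul (hzH x' x (adm_symm i hadm)) (hptR x x' hx') (mul_nonneg (w₀K_nonneg i α x') (norm_nonneg _)) hHz0)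
      _ = c * S₀ + c * Hz := by ring

end Index

/-! ## §3 ★★ The (3.43) co-reading `H1ReadsNbr` of `kernelFamilyB` on the coordinate model with the Hölder probes -/

section H1

variable [CompleteSpace 𝔸] [FiniteDimensional ℝ 𝔸] (i : KIdx d ℓ hd hL b₀ b₁) (b : Module.Basis κ ℝ 𝔸)
variable (B : B9.Backgrounds) (cfg : B.Cfg → CfgY 𝔸 i) (O : BondOpY 𝔸 i) (par : BondParY 𝔸 i) (U₁ : B.Cfg)
variable {bI : FBondY i → IBondY i}

omit [Fintype κ] in
/-- the bond-sector evaluation of `.inr J` IS the diagonal evaluation of `J`. [cite: Balaban1985BackgroundPropagators, (3.39) p.397, bookkeeping] -/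
private theorem evBK_inr' (J : FBondY i → ℝ) : evBK (κ := κ) i (Sum.inr J) = evDiagK J := rfl

/-- ★★ **`H1ReadsNbr (kernelFamilyB i B cfg O par) U₁ (holderProbesK …) (RelB i) r (blkBK bI) (blkBK bI) evBK evBK (DcoK ∘ₗ GcoK) (GcoK ∘ₗ DscoK)`** for
EVERY bond-sector letter `O`, EVERY `U₁` (no unitarity needed: the transported point probes read `R(U(Γ))Ψ` itself), every real basis `b`, every radius `r ≥ 2`,
given `bI` carrier-faithful on carrier blocks (`hβI`) and 1-faithful (`hβ1`): the (3.43) quantity `h1` of def-Y's reading — `sup_{‖E‖≤1} max (sup_ν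
‖ζ∇_{U,ν}O(J⊗E)‖_α, sup_ν ‖ζO∇*_{U,ν}(J⊗E)‖_α)` with the covariant Hölder quotient `holderQB` — is co-read by the models of `∇_UO`, `O∇*_U` through the
Hölder probes of the coordinate model (`holderQB_le_of_probes` twice). [cite: Balaban1985BackgroundPropagators, (3.43) p.398 + (3.40) p.397; Balaban1984PropagatorsII, (2.51)–(2.52) p.232 + (2.54) p.233] -/
theorem h1ReadsNbr_kernelFamilyB_coords [Fintype (geo9K i).Site]
    (hβI : ∀ (x : FBondY i) (c : IBondY i), blkV1 i.hN i.D x = β i.hN i.D i.hk c → β i.hN i.D i.hk (bI x) = blkV1 i.hN i.D x)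
    (hβ1 : ∀ x : FBondY i, (geomT i.D).dist (β i.hN i.D i.hk (bI x)) (blkV1 i.hN i.D x) ≤ 1) {r : ℝ} (hr : 2 ≤ r) :
    H1ReadsNbr (kernelFamilyB i B cfg O par) U₁ (holderProbesK i b B cfg par bI) (RelB i) r (blkBK i bI) (blkBK i bI) (evBK i) (evBK i)
      (DcoK i b B cfg U₁ ∘ₗ GcoK i b B cfg O U₁) (GcoK i b B cfg O U₁ ∘ₗ DscoK i b B cfg U₁) := by
  obtain ⟨hoff, hbd⟩ := off_bound_evBK (κ := κ) i hβI
  refine ⟨hoff, hbd, hoff, hbd, fun lam => geo9K_supNorm_nonneg i lam, fun α ζ => geo9K_cutH_nonneg i α ζ, ?_⟩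
  intro lam α ζ y c hc hcut hPY hPX
  have h0 : 0 ≤ c * (geo9K i).cutH α ζ := mul_nonneg hc (geo9K_cutH_nonneg i α ζ)
  cases lam with
  | inl f => cases ζ with
    | inl zz => exact h0
    | inr zz => exact h0
  | inr J => cases ζ with
    | inl zz => exact h0
    | inr zz =>
        show (⨆ E : BallY 𝔸, max (⨆ ν : Fin (d + 1), holderQB i (par (cfg U₁)) α zz (cdB i (cfg U₁) ν (O (cfg U₁) (liftY J (E : 𝔸)))))
            (⨆ ν : Fin (d + 1), holderQB i (par (cfg U₁)) α zz (O (cfg U₁) (cdsB i (cfg U₁) ν (liftY J (E : 𝔸)))))) ≤ c * (kGeo i).cutH α zz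
        rw [DcoK_comp_GcoK, evBK_inr'] at hPY
        rw [GcoK_comp_DscoK, evBK_inr'] at hPX
        refine iSup_ball_le (fun E => max_le (Real.iSup_le (fun ν => ?_) h0) (Real.iSup_le (fun ν => ?_) h0)) h0
        · exact holderQB_le_of_probes i b hβ1 hr (par (cfg U₁)) (fun ν => cdBₗ i (cfg U₁) ν ∘ₗ (O (cfg U₁)).restrictScalars ℝ) J α zz y hc
            hcut hPY E ν
        · exact holderQB_le_of_probes i b hβ1 hr (par (cfg U₁)) (fun ν => (O (cfg U₁)).restrictScalars ℝ ∘ₗ cdsBₗ i (cfg U₁) ν) J α zz y hc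
            hcut hPX E ν

end H1

/-! ## §4 ★ Under the certificate's pin equations (radius 2) -/

section Pins

variable [CompleteSpace 𝔸] [FiniteDimensional ℝ 𝔸] (i : KIdx d ℓ hd hL b₀ b₁) (b : Module.Basis κ ℝ 𝔸)
variable (B : B9.Backgrounds) (cfg : B.Cfg → CfgY 𝔸 i) (O : BondOpY 𝔸 i) (par : BondParY 𝔸 i) (U₁ : B.Cfg)
variable {bI : FBondY i → IBondY i}

/-- ★ **THE (3.43) CO-READING UNDER THE PINS, RADIUS 2**: for walk-letter block maps `blk = blkY = blkBK bI` and operators `G = GcoK …`, `D = DcoK …`,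
`Ds = DscoK …` (the pin equations displayed by the N06 certificate), `H1ReadsNbr (kernelFamilyB …) U₁ (holderProbesK …) (RelB i) 2 blk blkY evBK evBK (D ∘ₗ G)
(G ∘ₗ Ds)` HOLDS. [cite: Balaban1985BackgroundPropagators, (3.43) p.398 + (3.40) p.397; Balaban1984PropagatorsII, (2.51)–(2.52) p.232 + (2.54) p.233] -/
theorem bond_h1ReadsNbr_of_pins [Fintype (geo9K i).Site]
    (hβI : ∀ (x : FBondY i) (c : IBondY i), blkV1 i.hN i.D x = β i.hN i.D i.hk c → β i.hN i.D i.hk (bI x) = blkV1 i.hN i.D x)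
    (hβ1 : ∀ x : FBondY i, (geomT i.D).dist (β i.hN i.D i.hk (bI x)) (blkV1 i.hN i.D x) ≤ 1)
    {blk blkY : XBK κ i → IBondY i} {G D Ds : (XBK κ i → ℝ) →ₗ[ℝ] (XBK κ i → ℝ)} (hblk : blk = blkBK i bI) (hblkY : blkY = blkBK i bI)
    (hG : G = GcoK i b B cfg O U₁) (hD : D = DcoK i b B cfg U₁) (hDs : Ds = DscoK i b B cfg U₁) :
    H1ReadsNbr (kernelFamilyB i B cfg O par) U₁ (holderProbesK i b B cfg par bI) (RelB i) 2 blk blkY (evBK i) (evBK i) (D ∘ₗ G) (G ∘ₗ Ds) := by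
  subst hblk hblkY hG hD hDs
  exact h1ReadsNbr_kernelFamilyB_coords i b B cfg O par U₁ hβI hβ1 le_rfl

end Pins

end Literature.MathematicalPhysics.QuantumFieldTheory.Balaban1983to89.B9CoReadingCoordsHolder

end
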